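/-
Origin: expansion seat `planner-pub-hodgecm-pv02-g4-0`, handover #2 2026-08-18T07:13:24Z (`HOME/pub-hodgecm-pv02-g4/lean/Pv02g4/ArchAFockModel.lean`, md5 8b690e84, 310 lines);
landed by the gen-7 packager in gate run 25 as `HodgeCM/PerL34/ArchAFockModel.lean` (import ^import Pv[0-9]+g[0-9]+\.→import HodgeCM.PerL34. ×1; stripped 5 #print/#check/#eval lines).
-/
/-
Origin: HOME/pub-hodgecm-pv02-g4/lean/Pv02g4/ArchAFockModel.lean — session planner-pub-hodgecm-pv02-g4-0 (unit
pub-hodgecm-pv02-g4, DAG-NODE PROVER #02 gen 4).  Intended final place: `HodgeCM/PerL34/ArchAFockModel.lean`;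
namespaces `HodgeCM.PerL34.Fock` (§1) and `HodgeCM.PerL34.ArchA.FockLineModel` (§2).  Imports this seat's
`ArchAFock` (WIP `Pv02g4.ArchAFock` ↦ `HodgeCM.PerL34.ArchAFock`) and two Mathlib files.  Asserts nothing: no axiom,
no placeholder proof.
-/
import Summits.HodgeConjecture.HodgeCM.PerL34.ArchAFock_2
import Mathlib.LinearAlgebra.PiTensorProduct.Dual
import Mathlib.LinearAlgebra.Dual.Lemmas

set_option autoImplicit false

/-!
# The INTENDED instance of the N27 bridge — non-vacuity of `𝒮`, of the weight pieces and of `𝒮[b, kJ b]`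

`ArchAFock` (this seat, run 25) discharged the two PRINT inputs `WeightAction` / `WeightDecomposition` of pv02's
`ArchA.LineArchData.N27_of` over ANY `FockLineArchBridge` (slots `loc : Slot → LocalWeil`).  This leaf builds the
bridge the docstrings there call INTENDED and proves that nothing in it is the zero object:

* §1 `Fock.tprod_ne_zero` — a pure tensor of nonzero vectors of `ℂ`-vector spaces is nonzero (Mathlib's
  `PiTensorProduct.dualDistrib_apply` + `Module.Projective.exists_dual_eq_one`); the vacuum `1` and `z₁` are weight
  vectors of the named circles (`one_mem_weightSpace_harmCircle`, `one_mem_weightSpace_defCircle`,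
  `hz_zero_mem_weightSpace_harmCircle`).
* §2 `ArchA.FockLineModel` = the ArchA data of a line minus `𝒮, ω, piece, kJ`, plus the vacuum twists `kH` (slot of
  `ι₁`), `kD b` (slots `b ≠ ι₁`) and the finite-adelic factor `N`; from it: the slots
  `Slot := Option (Option {b // b ≠ ι₁})` (`none` = finite factor, `some none` = `ι₁`, `some (some b)` = `b ≠ ι₁`),
  `loc` = `LocalWeil.inert N` / `LocalWeil.harm kH` / `LocalWeil.def (kD b)` — LITERALLY the intended local Fock
  models of `FockKTypes` ((F1)–(F3), [Ad] §2 (2.1), [KV] II §§2–6) — `slotOf`, the COMPUTED naming datum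
  `kJ ι₁ = 1 + kH` (the `J⁺`-weight, `ArchAFock` §2″) / `kJ b = kD b` (`b ≠ ι₁`, the `𝟏_{U(3)}`-weight), and
  `toBridge Θ : FockLineArchBridge` for any theta kernel `Θ` on `𝒮 = ⨂_slots`.
* THEOREMS (all KERNEL, no hypothesis beyond `N ≠ 0` where stated): `tprod_vac_ne_zero` / `nontrivial_S` (`𝒮 ≠ 0`);
  `tprod_vac_mem_piece` (the vacuum tensor lies in `𝒮[b, kVac b]` for every real place `b`);
  `tprod_update_mem_piece_kJ` + `exists_jplus_vector` (a `J⁺`-vector in the slot of `ι₁` gives a vector of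
  `𝒮[ι₁, kJ ι₁]`); headline `piece_kJ_ne_bot : ∀ b, 𝒮[b, kJ b] ≠ ⊥` — the isotypic components about which N27
  (`FockLineArchBridge.N27_of_fock`, restated here as `N27_model`) speaks are NONZERO in the intended instance, so
  N27's remaining DEFINITIONAL input `ThetaKernel` is the only thing between the package and PerL v5 L4.1(a) for this
  model, and the statement it yields is not about the zero space.

References (notation only; nothing is cited as a hypothesis): [Ad] J. Adams, The theta correspondence over ℝ
(Edinburgh 1996), LMS LN 257 (1998) §2; [KV] M. Kashiwara, M. Vergne, Invent. Math. 44 (1978) 1–47, II §§2–6;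
[BW] A. Borel, N. Wallach, Continuous cohomology… (AMS 2000) VIII 2.7–2.14; PerL v5 (paper/theory/PerL_v5.tex)
ll. 262–266, 470–478 (the object under adjudication — quoted for notation, never cited).
-/

noncomputable section

open Function MvPolynomial
open scoped TensorProduct BigOperators

namespace HodgeCM
namespace PerL34

/-! ## §1 Pure tensors of nonzero vectors; the vacuum and `z₁` as weight vectors -/

namespace Fock

/-- A pure tensor of nonzero vectors of `ℂ`-vector spaces is nonzero: evaluate the product of dual vectors
`f_i` with `f_i (m_i) = 1` (`PiTensorProduct.dualDistrib`). -/
theorem tprod_ne_zero {ι : Type} [Fintype ι] {M : ι → Type} [∀ i, AddCommGroup (M i)] [∀ i, Module ℂ (M i)]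
    (m : Π i, M i) (hm : ∀ i, m i ≠ 0) : PiTensorProduct.tprod ℂ m ≠ 0 := by
  choose f hf using fun i => Module.Projective.exists_dual_eq_one ℂ (hm i)
  intro h
  have h1 := PiTensorProduct.dualDistrib_apply f m
  rw [h, map_zero, Finset.prod_eq_one (fun i _ => hf i)] at h1
  exact zero_ne_one h1

/-- (Ported verbatim from the HodgeCMPerL package; no docstring in the source.) -/
theorem wt_zero {σ : Type} [Fintype σ] (s : σ → ℤ) : wt s 0 = 0 := by
  simp [wt]

/-- The constants are weight-`k₀` vectors of the circle `u ↦ u^{k₀} · (X_i ↦ u^{s_i} X_i)`. -/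
theorem C_mem_weightSpace_circleScale {σ : Type} [Fintype σ] (s : σ → ℤ) (k₀ : ℤ) (c : ℂ) :
    (C c : MvPolynomial σ ℂ) ∈ weightSpace (circleScale s k₀) k₀ := by
  rw [weightSpace_circleScale_eq, sub_self, C_apply]
  exact monomial_mem_wpiece (wt_zero s) c

/-- the vacuum `1 ∈ ℂ[z₁,z₂,w]` has weight `k₀` under `harmCircle k₀` -/
theorem one_mem_weightSpace_harmCircle (k₀ : ℤ) : (1 : HarmModel) ∈ weightSpace (harmCircle k₀) k₀ := by
  rw [← C_1]
  exact C_mem_weightSpace_circleScale uWt k₀ 1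

/-- the vacuum `1 ∈ ℂ[z₁,z₂,z₃]` has weight `k₀` under `defCircle k₀` -/
theorem one_mem_weightSpace_defCircle (k₀ : ℤ) : (1 : DefModel) ∈ weightSpace (defCircle k₀) k₀ := by
  rw [← C_1]
  exact C_mem_weightSpace_circleScale (fun _ : Fin 3 => (1 : ℤ)) k₀ 1

/-- `z₁ ∈ J⁺ = F_1` has weight `1 + k₀` under `harmCircle k₀` -/
theorem hz_zero_mem_weightSpace_harmCircle (k₀ : ℤ) : hz 0 ∈ weightSpace (harmCircle k₀) (1 + k₀) := by
  rw [weightSpace_harmCircle_one_add]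
  exact hz_zero_mem_jplus

/-- (Ported verbatim from the HodgeCMPerL package; no docstring in the source.) -/
theorem hz_zero_ne_zero : hz 0 ≠ 0 := by
  rw [hz_zero_eq]
  exact hmon_ne_zero 1 0 0

end Fock

/-! ## §2 The intended bridge -/

namespace ArchA

open MeasureTheory Fock

/-- The ArchA data of a line `𝓛 = 𝓛(χ₁,χ₂,χ₃)` WITHOUT `𝒮, ω, piece, kJ` (those are built below from the local Fock
models), PLUS the vacuum twists of the Weil representation at the real places and the finite-adelic factor.  Every
other field is `ArchA.LineArchData`'s, verbatim. -/
structure FockLineModel where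
  /-- the real places `b` of `L₀`. -/
  RealPl : Type
  [iR₁ : Fintype RealPl]
  [iR₂ : DecidableEq RealPl]
  /-- the distinguished real place `ι₁`. -/
  ι₁ : RealPl
  /-- `[U(W_i)] = U(W_i)(L₀)\U(W_i)(𝔸)`, a compact group (tex l. 266). -/
  Q : Type
  [iQ₁ : Group Q]
  [iQ₂ : TopologicalSpace Q]
  [iQ₃ : IsTopologicalGroup Q]
  [iQ₄ : CompactSpace Q]
  [iQ₅ : MeasurableSpace Q]
  [iQ₆ : BorelSpace Q]
  /-- the Haar probability measure `du` on `[U(W_i)]`. -/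
  μ : Measure Q
  [iμ₁ : IsProbabilityMeasure μ]
  [iμ₂ : μ.IsMulRightInvariant]
  /-- the image of `U(W_{i,b}) = U(1)` (real place `b`) in `[U(W_i)]`. -/
  toQ : RealPl → (Circle →* Q)
  /-- automorphic forms on `[G_U]` (only the Banach-space structure is used). -/
  A : Type
  [iA₁ : NormedAddCommGroup A]
  [iA₂ : NormedSpace ℂ A]
  [iA₃ : CompleteSpace A]
  /-- the vacuum twist of `ω|_{U(W_{i,ι₁})}` on `ℂ[z₁,z₂,w]` (signature `(2,1)` at `ι₁`; [KV] II §6, half-integral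
  weights cleared as in [BW] VIII 2.7). -/
  kH : ℤ
  /-- the vacuum twists of `ω|_{U(W_{i,b})}` on `ℂ[z₁,z₂,z₃]` at the places `b ≠ ι₁` (value at `ι₁` unused). -/
  kD : RealPl → ℤ
  /-- the finite-adelic factor `𝒮(V(𝔸_f))` — no archimedean circle acts on it. -/
  N : Type
  [iN₁ : AddCommGroup N]
  [iN₂ : Module ℂ N]
  /-- automorphic characters `χ'` of `[U(W_i)]`. -/
  X : Type
  /-- `χ'` as a character of `[U(W_i)]`. -/
  χQ : X → (Q →* Circle)

attribute [instance] FockLineModel.iR₁ FockLineModel.iR₂ FockLineModel.iQ₁ FockLineModel.iQ₂ FockLineModel.iQ₃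
  FockLineModel.iQ₄ FockLineModel.iQ₅ FockLineModel.iQ₆ FockLineModel.iμ₁ FockLineModel.iμ₂ FockLineModel.iA₁
  FockLineModel.iA₂ FockLineModel.iA₃ FockLineModel.iN₁ FockLineModel.iN₂

namespace FockLineModel

variable (C : FockLineModel)

/-- the tensor slots: `none` = the finite-adelic factor, `some none` = the place `ι₁`, `some (some b)` = `b ≠ ι₁`. -/
abbrev Slot : Type := Option (Option {b : C.RealPl // b ≠ C.ι₁})

/-- the local Weil factor in each slot — LITERALLY the local Fock models of `FockKTypes`. -/
def loc : C.Slot → LocalWeil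
  | none => LocalWeil.inert C.N
  | some none => LocalWeil.harm C.kH
  | some (some b) => LocalWeil.def (C.kD b.1)

/-- the slot of the real place `b`. -/
def slotOf (b : C.RealPl) : C.Slot := if h : b = C.ι₁ then some none else some (some ⟨b, h⟩)

/-- (Ported verbatim from the HodgeCMPerL package; no docstring in the source.) -/
theorem slotOf_ι₁ : C.slotOf C.ι₁ = some none := dif_pos rfl

/-- (Ported verbatim from the HodgeCMPerL package; no docstring in the source.) -/
theorem slotOf_of_ne {b : C.RealPl} (h : b ≠ C.ι₁) : C.slotOf b = some (some ⟨b, h⟩) := dif_neg h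

/-- the vacuum weight in the slot of `b`. -/
def kVac (b : C.RealPl) : ℤ := if b = C.ι₁ then C.kH else C.kD b

/-- (Ported verbatim from the HodgeCMPerL package; no docstring in the source.) -/
theorem kVac_ι₁ : C.kVac C.ι₁ = C.kH := if_pos rfl

/-- (Ported verbatim from the HodgeCMPerL package; no docstring in the source.) -/
theorem kVac_of_ne {b : C.RealPl} (h : b ≠ C.ι₁) : C.kVac b = C.kD b := if_neg h

/-- **the COMPUTED naming datum** `kJ`: the `J⁺`-weight `1 + kH` at `ι₁` (`ArchAFock` §2″,
`Fock.mem_weightSpace_harmCircle_iff_inJplus`), the `𝟏_{U(3)}` = vacuum weight `kD b` at `b ≠ ι₁`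
(`Fock.mem_weightSpace_defCircle_self_iff`). -/
def kJ (b : C.RealPl) : ℤ := if b = C.ι₁ then 1 + C.kH else C.kD b

/-- (Ported verbatim from the HodgeCMPerL package; no docstring in the source.) -/
theorem kJ_ι₁ : C.kJ C.ι₁ = 1 + C.kH := if_pos rfl

/-- (Ported verbatim from the HodgeCMPerL package; no docstring in the source.) -/
theorem kJ_of_ne {b : C.RealPl} (h : b ≠ C.ι₁) : C.kJ b = C.kD b := if_neg h

/-- `𝒮 := ⨂_slots` of the intended local models. -/
abbrev S : Type := ⨂[ℂ] i : C.Slot, (C.loc i).M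

/-- **the intended bridge** with theta kernel `Θ` (tex ll. 262–265) — every ArchA field verbatim, the slots as above. -/
def toBridge (Θ : C.S →ₗ[ℂ] (C.Q → C.A)) : FockLineArchBridge where
  RealPl := C.RealPl
  ι₁ := C.ι₁
  Q := C.Q
  μ := C.μ
  toQ := C.toQ
  A := C.A
  Slot := C.Slot
  loc := C.loc
  slotOf := C.slotOf
  Θ := Θ
  kJ := C.kJ
  X := C.X
  χQ := C.χQ

variable (Θ : C.S →ₗ[ℂ] (C.Q → C.A))

/-- (Ported verbatim from the HodgeCMPerL package; no docstring in the source.) -/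
theorem toBridge_S : (C.toBridge Θ).S = C.S := rfl

/-- (Ported verbatim from the HodgeCMPerL package; no docstring in the source.) -/
theorem toBridge_kJ : (C.toBridge Θ).kJ = C.kJ := rfl

/-- (Ported verbatim from the HodgeCMPerL package; no docstring in the source.) -/
theorem toBridge_piece (b : C.RealPl) (k : ℤ) :
    (C.toBridge Θ).piece b k = weightSpace (slotAct (M := fun i => (C.loc i).M) (C.slotOf b) (C.loc (C.slotOf b)).ρ) k :=
  rfl

/-- **N27 for the intended model** (= `FockLineArchBridge.N27_of_fock`): only the DEFINITIONAL `ThetaKernel` is an input. -/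
theorem N27_model (hT : (C.toBridge Θ).toLineArchData.ThetaKernel) : (C.toBridge Θ).toLineArchData.N27_statement :=
  (C.toBridge Θ).N27_of_fock hT

/-- the components of the vacuum tensor: `1` in each polynomial slot, `n` in the finite slot. -/
def vac (n : C.N) : Π i : C.Slot, (C.loc i).M
  | none => n
  | some none => (1 : HarmModel)
  | some (some _) => (1 : DefModel)

/-- (Ported verbatim from the HodgeCMPerL package; no docstring in the source.) -/
theorem vac_ne_zero {n : C.N} (hn : n ≠ 0) : ∀ i : C.Slot, C.vac n i ≠ 0
  | none => hn
  | some none => (one_ne_zero : (1 : HarmModel) ≠ 0)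
  | some (some _) => (one_ne_zero : (1 : DefModel) ≠ 0)

/-- the vacuum component in the slot of `b` is a weight-`kVac b` vector of that slot's circle -/
theorem vac_mem_weightSpace (n : C.N) (b : C.RealPl) :
    C.vac n (C.slotOf b) ∈ weightSpace (C.loc (C.slotOf b)).ρ (C.kVac b) := by
  by_cases h : b = C.ι₁
  · subst h
    rw [C.slotOf_ι₁, C.kVac_ι₁]
    exact one_mem_weightSpace_harmCircle C.kH
  · rw [C.slotOf_of_ne h, C.kVac_of_ne h]
    exact one_mem_weightSpace_defCircle (C.kD b)

/-- **`𝒮 ≠ 0`**: the vacuum tensor is nonzero (for a nonzero finite-adelic test vector `n`). -/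
theorem tprod_vac_ne_zero {n : C.N} (hn : n ≠ 0) : PiTensorProduct.tprod ℂ (C.vac n) ≠ 0 :=
  tprod_ne_zero (C.vac n) (C.vac_ne_zero hn)

/-- (Ported verbatim from the HodgeCMPerL package; no docstring in the source.) -/
theorem nontrivial_S [Nontrivial C.N] : Nontrivial C.S := by
  obtain ⟨n, hn⟩ := exists_ne (0 : C.N)
  exact ⟨⟨PiTensorProduct.tprod ℂ (C.vac n), 0, C.tprod_vac_ne_zero hn⟩⟩

/-- the vacuum tensor lies in `𝒮[b, kVac b]` for EVERY real place `b` -/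
theorem tprod_vac_mem_piece (n : C.N) (b : C.RealPl) :
    PiTensorProduct.tprod ℂ (C.vac n) ∈ (C.toBridge Θ).piece b (C.kVac b) := by
  have h : PiTensorProduct.tprod ℂ (update (C.vac n) (C.slotOf b) (C.vac n (C.slotOf b))) ∈
      (C.toBridge Θ).piece b (C.kVac b) :=
    (C.toBridge Θ).tprod_update_mem_piece b (C.vac n) (C.vac_mem_weightSpace n b)
  rwa [update_eq_self] at h

/-- a `J⁺`-weight vector `x` in the slot of `ι₁` tensored with the vacua lies in `𝒮[ι₁, kJ ι₁]` -/
theorem tprod_update_mem_piece_kJ (n : C.N) {x : (C.loc (C.slotOf C.ι₁)).M}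
    (hx : x ∈ weightSpace (C.loc (C.slotOf C.ι₁)).ρ (1 + C.kH)) :
    PiTensorProduct.tprod ℂ (update (C.vac n) (C.slotOf C.ι₁) x) ∈ (C.toBridge Θ).piece C.ι₁ (C.kJ C.ι₁) := by
  rw [C.kJ_ι₁]
  exact (C.toBridge Θ).tprod_update_mem_piece C.ι₁ (C.vac n) hx

/-- … and such vectors exist: `z₁` (`Fock.hz_zero_mem_weightSpace_harmCircle`). -/
theorem exists_jplus_vector :
    ∃ x : (C.loc (C.slotOf C.ι₁)).M, x ≠ 0 ∧ x ∈ weightSpace (C.loc (C.slotOf C.ι₁)).ρ (1 + C.kH) := by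
  rw [C.slotOf_ι₁]
  exact ⟨hz 0, hz_zero_ne_zero, hz_zero_mem_weightSpace_harmCircle C.kH⟩

/-- (Ported verbatim from the HodgeCMPerL package; no docstring in the source.) -/
theorem update_vac_ne_zero {n : C.N} (hn : n ≠ 0) (j : C.Slot) {x : (C.loc j).M} (hx : x ≠ 0) (i : C.Slot) :
    update (C.vac n) j x i ≠ 0 := by
  by_cases h : i = j
  · subst h
    rw [update_self]
    exact hx
  · rw [update_of_ne h]
    exact C.vac_ne_zero hn i

/-- **HEADLINE — non-vacuity of N27's isotypic components in the intended instance**: for every real place `b`,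
`𝒮[b, kJ b] ≠ 0` (at `ι₁`: `z₁ ⊗ vacua`; at `b ≠ ι₁`: the vacuum tensor). -/
theorem piece_kJ_ne_bot [Nontrivial C.N] (b : C.RealPl) : (C.toBridge Θ).piece b (C.kJ b) ≠ ⊥ := by
  obtain ⟨n, hn⟩ := exists_ne (0 : C.N)
  rw [Submodule.ne_bot_iff]
  by_cases h : b = C.ι₁
  · subst h
    obtain ⟨x, hx0, hx⟩ := C.exists_jplus_vector
    exact ⟨_, C.tprod_update_mem_piece_kJ Θ n hx, tprod_ne_zero _ (C.update_vac_ne_zero hn _ hx0)⟩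
  · refine ⟨_, ?_, C.tprod_vac_ne_zero hn⟩
    rw [C.kJ_of_ne h, ← C.kVac_of_ne h]
    exact C.tprod_vac_mem_piece Θ n b

/-- the same for the `LineArchData` view consumed by `ArchA` (`HasArchJ`-type hypotheses are satisfiable). -/
theorem lineArchData_piece_kJ_ne_bot [Nontrivial C.N] (b : C.RealPl) :
    (C.toBridge Θ).toLineArchData.piece b ((C.toBridge Θ).toLineArchData.kJ b) ≠ ⊥ :=
  C.piece_kJ_ne_bot Θ b

end FockLineModel

end ArchA

end PerL34
end HodgeCM

end

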